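import Summits.ABC.ABC.Theorems.PadicPrimesYuNinetyRung
import HarnessLib

/-!
# Cell abc-stewartyu, rung F-A1 (M3): the one-prime case `#S ≤ 1` of the Yu-2007-quality texts
# `Y07Odd` / `Y07Two` of the staged route `PadicPrimesKummerThird` (BC5 witness)

`Summits/ABC/StewartYu/PadicPrimesKummerThirdRung.lean` — cell `abc-stewartyu` (seat p2; planner WANTED
M3-BRIEF §8 2026-08-26T12:15Z, plan-m3 12:52Z: a TREE witness for the birth tribunal of the staged route
`PadicPrimesKummerThird`, whose crux texts `Y07Odd` (odd `p`) / `Y07Two` (`p = 2`) read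
`ord_p(∏_{q∈S} q^{e_q} − 1)·log p < c₆^{#S} · (p/log p) · (log p + log B + log log max(4, max S)) · ∏ log q`).
Here: the ONE-PRIME case `#S ≤ 1` (one logarithm) of both texts VERBATIM (the binder `S.card ≤ 1` inserted
after `S.Nonempty`), with the absolute constant `c₆ = 4`, from the tree's one-logarithm estimates
`Dioph.padicValRat_zpow_sub_one_mul_log_le'` (odd `p`: `v·log p ≤ 2(p−1)·h(q) + log|e|`) and
`Dioph.padicValRat_zpow_sub_one_mul_log_le_two` (`p = 2`: `v·log 2 ≤ log 2 + 2h(q) + log|e|`),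
`h(q) = log q`.  Support mathematics filed on the cell side before the route opens; the route's
`Theorems/` rung re-exports `y07Odd_card_one` / `y07Two_card_one` by name once its items exist.
WHAT THIS IS NOT: not the cruxes (all `#S`), which need a Gen-3 (Yu 2007) engine.
-/

namespace Summit.ABC.StewartYu

open Finset Real Height
open Literature.NumberTheory.DiophantineGeometry
open Summit.ABC.ABC.Theorems.PadicPrimesYuNinetyRung (loglog_max_four_ge)

/-- Numerical door, odd `p`: `2(P−1)X + Y < 4·(P/lp)·(lp + Y + L₂)·X` for `P ≥ 2`, `0 < lp ≤ P − 1`,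
`X ≥ 0.69`, `Y ≥ 1`, `L₂ ≥ 0`. [folklore] -/
theorem y07_door_odd {P lp X Y L₂ : ℝ} (hP : 2 ≤ P) (hlp : 0 < lp) (hlpP : lp ≤ P - 1) (hX : 0.69 ≤ X)
    (hY : 1 ≤ Y) (hL : 0 ≤ L₂) :
    2 * (P - 1) * X + Y < 4 * (P / lp) * (lp + Y + L₂) * X := by
  have hPl : 1 ≤ P / lp := by
    rw [le_div_iff₀ hlp]; linarith
  have hPlp : P ≤ P / lp * (P - 1) := by
    have : P / lp * lp = P := div_mul_cancel₀ P hlp.ne'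
    nlinarith
  -- `(P/lp)·lp·X = P·X` and `(P/lp)·Y·X ≥ Y·X ≥ 0.69 Y`
  have h1 : 4 * (P / lp) * (lp + Y + L₂) * X =
      4 * P * X + 4 * (P / lp) * Y * X + 4 * (P / lp) * L₂ * X := by
    have e : P / lp * lp = P := div_mul_cancel₀ P hlp.ne'
    calc 4 * (P / lp) * (lp + Y + L₂) * X
        = 4 * (P / lp * lp) * X + 4 * (P / lp) * Y * X + 4 * (P / lp) * L₂ * X := by ring
      _ = _ := by rw [e]
  have h2 : Y * X ≤ (P / lp) * Y * X := by
    have : 0 ≤ Y * X := by positivity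
    nlinarith
  have h3 : 0 ≤ 4 * (P / lp) * L₂ * X := by positivity
  have h4 : 0.69 * Y ≤ Y * X := by nlinarith
  nlinarith

/-- Numerical door, `p = 2`: `0.7 + 2X + Y < 4·(2/l₂)·(l₂ + Y + L₂)·X` for `0.69 ≤ l₂ ≤ 0.7`,
`X ≥ 1`, `Y ≥ 1`, `L₂ ≥ 0`. [folklore] -/
theorem y07_door_two {l₂ X Y L₂ : ℝ} (hl : 0.69 ≤ l₂) (hl' : l₂ ≤ 0.7) (hX : 1 ≤ X) (hY : 1 ≤ Y)
    (hL : 0 ≤ L₂) :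
    0.7 + 2 * X + Y < 4 * (2 / l₂) * (l₂ + Y + L₂) * X := by
  have hl0 : 0 < l₂ := by linarith
  have hq : 2 ≤ 2 / l₂ := by rw [le_div_iff₀ hl0]; linarith
  have h1 : 4 * (2 / l₂) * (l₂ + Y + L₂) * X =
      8 * X + 4 * (2 / l₂) * Y * X + 4 * (2 / l₂) * L₂ * X := by
    have e : 2 / l₂ * l₂ = 2 := div_mul_cancel₀ 2 hl0.ne'
    calc 4 * (2 / l₂) * (l₂ + Y + L₂) * X
        = 4 * (2 / l₂ * l₂) * X + 4 * (2 / l₂) * Y * X + 4 * (2 / l₂) * L₂ * X := by ring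
      _ = _ := by rw [e]; ring
  have h2 : 2 * Y ≤ (2 / l₂) * Y * X := by
    have : 0 ≤ Y * X := by positivity
    nlinarith
  have h3 : 0 ≤ 4 * (2 / l₂) * L₂ * X := by positivity
  nlinarith

/-- **The one-prime case `#S ≤ 1` of the Yu-2007-quality text, all primes `p` at once**, `c₆ = 4`:
for primes `p ∉ S = {q}`, `|e| ≤ B` (`B ≥ 3`), `q^e ≠ 1`,
`ord_p(q^e − 1)·log p < 4^{#S}·(p/log p)·(log p + log B + log log max(4,q))·log q`. [folklore] -/
theorem y07_card_one : ∀ (p : ℕ), p.Prime → ∀ (S : Finset ℕ), (∀ q ∈ S, q.Prime) → p ∉ S →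
      S.Nonempty → S.card ≤ 1 →
      ∀ (e : ℕ → ℤ) (B : ℝ), 3 ≤ B → (∀ q ∈ S, (|e q| : ℝ) ≤ B) →
      ∏ q ∈ S, (q : ℚ) ^ e q ≠ 1 →
      (padicValRat p (∏ q ∈ S, (q : ℚ) ^ e q - 1) : ℝ) * Real.log p <
        (4 : ℝ) ^ S.card * ((p : ℝ) / Real.log p) *
          (Real.log p + Real.log B + Real.log (Real.log ((max 4 (S.sup id) : ℕ) : ℝ))) *
          ∏ q ∈ S, Real.log (q : ℝ) := by
  intro p hp S hS hpS hne hcard e B hB heB hne1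
  obtain ⟨q, rfl⟩ := Finset.card_eq_one.mp (le_antisymm hcard (Finset.card_pos.mpr hne))
  have hq : q.Prime := hS q (mem_singleton_self q)
  have hqp : q ≠ p := fun h => hpS (h ▸ mem_singleton_self q)
  simp only [prod_singleton, sup_singleton, id, card_singleton, pow_one] at hne1 heB ⊢
  set t : ℤ := e q with ht_def
  have ht : t ≠ 0 := by
    intro h0; apply hne1; rw [h0, zpow_zero]
  -- the quantities
  set X : ℝ := Real.log (q : ℝ) with hX_def
  set Y : ℝ := Real.log B with hY_def
  set L₂ : ℝ := Real.log (Real.log ((max 4 q : ℕ) : ℝ)) with hL_def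
  have hL : (0 : ℝ) ≤ L₂ := le_trans (by norm_num) (loglog_max_four_ge q)
  have hY1 : (1 : ℝ) ≤ Y := by
    have h3 : (1 : ℝ) ≤ Real.log 3 := by
      rw [← Real.log_exp 1]
      exact Real.log_le_log (Real.exp_pos 1) (by have := Real.exp_one_lt_d9; linarith)
    exact h3.trans (Real.log_le_log (by norm_num) hB)
  have hq0 : (q : ℚ) ≠ 0 := by exact_mod_cast hq.ne_zero
  have hqpos : (0 : ℝ) < q := by exact_mod_cast hq.pos
  have hq2 : (2 : ℝ) ≤ q := by exact_mod_cast hq.two_le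
  have hl2 : (0.69 : ℝ) ≤ Real.log 2 := by have := Real.log_two_gt_d9; linarith
  have hl2' : Real.log 2 ≤ 0.7 := by have := Real.log_two_lt_d9; linarith
  have hX069 : (0.69 : ℝ) ≤ X := hl2.trans (Real.log_le_log (by norm_num) hq2)
  have hlogt : Real.log |(t : ℝ)| ≤ Y := by
    have htpos : (0 : ℝ) < |(t : ℝ)| := abs_pos.mpr (by exact_mod_cast ht)
    exact Real.log_le_log htpos (heB q (mem_singleton_self q))
  have hqv : padicValRat p (q : ℚ) = 0 :=
    Literature.Barriers.ABC.StewartTijdemanGeneric.padicValRat_natCast_prime_of_ne hp hq hqp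
  have hh : logHeight₁ (q : ℚ) = Real.log q := by
    haveI : NeZero q := ⟨hq.ne_zero⟩
    exact Rat.logHeight₁_natCast q
  have hp0 : (0 : ℝ) < p := by exact_mod_cast hp.pos
  have hP2 : (2 : ℝ) ≤ p := by exact_mod_cast hp.two_le
  have hlp0 : 0 < Real.log (p : ℝ) := Real.log_pos (by linarith)
  rcases eq_or_ne p 2 with rfl | hp2
  · -- p = 2: `v·log 2 ≤ log 2 + 2 log q + log|t|`, and `q ≥ 3`
    have h := Dioph.padicValRat_zpow_sub_one_mul_log_le_two hq0 hqv ht hne1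
    rw [hh] at h
    have hq3 : (3 : ℝ) ≤ q := by
      have : q ≠ 2 := hqp
      exact_mod_cast (by have := hq.two_le; omega : 3 ≤ q)
    have hX1 : (1 : ℝ) ≤ X := by
      have h3 : (1 : ℝ) ≤ Real.log 3 := by
        rw [← Real.log_exp 1]
        exact Real.log_le_log (Real.exp_pos 1) (by have := Real.exp_one_lt_d9; linarith)
      exact h3.trans (Real.log_le_log (by norm_num) hq3)
    have hd := y07_door_two hl2 hl2' hX1 hY1 hL
    push_cast at h hd ⊢
    linarith
  · -- p odd: `v·log p ≤ 2(p−1) log q + log|t|`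
    have hq1 : (q : ℚ) ≠ 1 := by exact_mod_cast hq.one_lt.ne'
    have hqm1 : (q : ℚ) ≠ -1 := by
      have : (0 : ℚ) ≤ q := by exact_mod_cast (Nat.zero_le q)
      intro h; rw [h] at this; norm_num at this
    have h := Dioph.padicValRat_zpow_sub_one_mul_log_le' hp hp2 hq0 hqv hq1 hqm1 ht
    rw [hh, Nat.cast_natAbs, Int.cast_abs] at h
    have hlpP : Real.log (p : ℝ) ≤ (p : ℝ) - 1 := Real.log_le_sub_one_of_pos hp0
    have hd := y07_door_odd hP2 hlp0 hlpP hX069 hY1 hL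
    linarith

/-- **Rung (BC5) for `Y07Odd`**: the Yu-2007-quality text at odd `p` when `#S ≤ 1`, `c₆ = 4`. [folklore] -/
theorem y07Odd_card_one : ∃ c₆ : ℝ, ∀ (p : ℕ), p.Prime → p ≠ 2 →
    ∀ (S : Finset ℕ), (∀ q ∈ S, q.Prime) → p ∉ S → S.Nonempty → S.card ≤ 1 →
      ∀ (e : ℕ → ℤ) (B : ℝ), 3 ≤ B → (∀ q ∈ S, (|e q| : ℝ) ≤ B) →
      ∏ q ∈ S, (q : ℚ) ^ e q ≠ 1 →
      (padicValRat p (∏ q ∈ S, (q : ℚ) ^ e q - 1) : ℝ) * Real.log p <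
        c₆ ^ S.card * ((p : ℝ) / Real.log p) *
          (Real.log p + Real.log B + Real.log (Real.log ((max 4 (S.sup id) : ℕ) : ℝ))) *
          ∏ q ∈ S, Real.log (q : ℝ) :=
  ⟨4, fun p hp _ S hS hpS hne hcard e B hB heB hne1 =>
    y07_card_one p hp S hS hpS hne hcard e B hB heB hne1⟩

/-- **Rung (BC5) for `Y07Two`**: the Yu-2007-quality text at `p = 2` when `#S ≤ 1`, `c₆ = 4`. [folklore] -/
theorem y07Two_card_one : ∃ c₆ : ℝ,
    ∀ (S : Finset ℕ), (∀ q ∈ S, q.Prime) → 2 ∉ S → S.Nonempty → S.card ≤ 1 →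
      ∀ (e : ℕ → ℤ) (B : ℝ), 3 ≤ B → (∀ q ∈ S, (|e q| : ℝ) ≤ B) →
      ∏ q ∈ S, (q : ℚ) ^ e q ≠ 1 →
      (padicValRat 2 (∏ q ∈ S, (q : ℚ) ^ e q - 1) : ℝ) * Real.log 2 <
        c₆ ^ S.card * ((2 : ℝ) / Real.log 2) *
          (Real.log 2 + Real.log B + Real.log (Real.log ((max 4 (S.sup id) : ℕ) : ℝ))) *
          ∏ q ∈ S, Real.log (q : ℝ) :=
  ⟨4, fun S hS h2S hne hcard e B hB heB hne1 => by
    have h := y07_card_one 2 Nat.prime_two S hS h2S hne hcard e B hB heB hne1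
    simpa only [Nat.cast_ofNat] using h⟩

end Summit.ABC.StewartYu
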